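import Summits.QuantumFields.YangMills.Theorems.UnitScaleTiltProp7PinnedPeelingEL
import HarnessLib

/-!
# Route `UnitScaleTilt`, crux K1 «MinimiserStabilityRegPr» (stmt-QuantumFields-19200), route-R E′ path (α′), residue (hK), assembly (A), brick (S):
# THE THREE EULER–LAGRANGE SOURCES OF THE PEELED KERNEL HAVE WEIGHTED ℓ² SIZES `Ω·(pointwise bound)·√(support count)` — the numbers `Nh`, `Nht`, `Ns`
# (and the commutator half of `N₂`) of ✓ `Prop7PinnedKernelL1OfRows.sum_abs_laplace_sub_interp_le_of_rows`, from POINTWISE rows on a finite set `T`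
# off which the cutoff `χ` is locally constant

Cell `ym3-torus`, width seat `ym3-torus-px22` (gen 2) = the (A)-instantiation seat (★routeR-w3 g5 19:59:56Z); LOCATE 19200 evidence `LOCATE-A3-FARFIELD-px22g2.md`
v1.2 §3.  `--supports stmt-QuantumFields-19200`, count-neutral.  THEOREMS ONLY (0 `def`, 0 `sorry`).  YM₃ on T³ is a ladder rung (R3), not the Clay problem; nothing here
claims the stub, the crux, d = 4 or the gap.

THE POINT.  With `χ` locally constant off `T` (at the consumer: `T` = the annulus `{2ℓ − 1 < tdist(·, b₋) < 10√dℓ + 1}`), the sources `h = χg − Δ(χV) = −[Δ,χ]V`,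
`ht(b′) = −g(b′₋)∂χ(b′)`, `s = Σ_μ ∂χ·∂g` of ✓ `Prop7PinnedPeelingEL.el_of_peeled` VANISH off `T` (✓ `h_eq_zero_of_locally_const` & co.), and ON `T` they are bounded
pointwise by ✓ `abs_laplace_mul_sub_mul_laplace_le` and the rows `|δχ| ≤ C₁`, `|δ²χ| ≤ C₂`, `|V(z+μ) − V(z−μ)| ≤ D₁`, `|V(z−μ)| ≤ D₀`, `|g| ≤ Dg`, `|g(z+μ) − g(z)| ≤ Dg′`
on `T`; a weight `ω ≤ Ω` on `T` then gives `√Σ(ω·source)² ≤ Ω·(bound)·√|T|`.  At scale ℓ: `|T| ≍ ℓ³`, `C₁ ≍ ℓ⁻¹`, `C₂ ≍ ℓ⁻²`, `D₀ ≍ 1` ((R2)), `D₁ ≍ ℓ⁻¹` ((R3a)),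
`Dg ≍ ℓ⁻²` ((N)), `Dg′ ≍ ℓ⁻³` ((Hess3)) ⇒ `Nh ≍ ℓ^{−1∕2}`, `Nht ≍ ℓ^{−3∕2}`, `Ns ≍ ℓ^{−5∕2}`.

WHAT IS PROVED (ns `…Theorems.Prop7PinnedKernelSources`; torus `T^{(j)}`, any `d`, lattice factor `c`, real site fields).
* §1 `sum_sq_le_card_mul_sq_of_supported`, `sqrt_sum_sq_weighted_le_of_supported` (sites), `sqrt_sum_sq_weighted_bond_le_of_supported` (bonds), `sum_abs_le_card_mul_of_supported`.
* §2 ★★ `sqrt_sum_sq_weighted_h_le` (`Nh ≤ Ω·d·c²(C₁D₁ + C₂D₀)·√|T|`), ★★ `sqrt_sum_sq_weighted_ht_le` (`Nht ≤ Ω·Dg·|c|C₁·√(d|T|)`),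
  ★★ `sqrt_sum_sq_weighted_s_le` (`Ns ≤ Ω·d·|c|C₁·|c|Dg′·√|T|`), ★ `sum_abs_laplace_mul_le` (`Σ|Δ(χV)| ≤ Σ|χ·g| + |T|·d·c²(C₁D₁ + C₂D₀)`).
HONEST SCOPE.  Bookkeeping only; `T`, the rows and `Ω` are displayed; no Green-function letter, no weight construction, no count of `|T|` here.

References: T. Bałaban, CMP 96 (1984) 223–250 [Balaban1984PropagatorsII] ((1.9) p.226, (2.61) p.234); CMP 99 (1985) 75–102 [Balaban1985RegularSpaces] ((1.36) p.82).
-/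

set_option autoImplicit false

noncomputable section

open scoped BigOperators

namespace Summit.QuantumFields.YangMills.Theorems.Prop7PinnedKernelSources

open Literature.MathematicalPhysics.QuantumFieldTheory.Balaban1983to89
open Finset LatticeFieldCalculus
open B10StarCount (sum_pbond)
open Summit.QuantumFields.YangMills.Theorems.Prop7PinnedPeelingEL

variable {P : Params} {j : ℕ}

/-! ## §1 Supported sums -/

/-- `Σ_z F(z)² ≤ |T|·B²` if `|F| ≤ B` on `T` and `F = 0` off `T`. [folklore] -/
theorem sum_sq_le_card_mul_sq_of_supported (T : Finset (Site P j)) (F : SiteField P j ℝ) {B : ℝ}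
    (hB : ∀ z ∈ T, |F z| ≤ B) (h0 : ∀ z ∉ T, F z = 0) :
    ∑ z, F z ^ 2 ≤ T.card * B ^ 2 := by
  classical
  have hsplit : ∑ z, F z ^ 2 = ∑ z ∈ T, F z ^ 2 := by
    rw [← Finset.sum_subset (Finset.subset_univ T)]
    intro z _ hz
    rw [h0 z hz]; ring
  rw [hsplit]
  calc ∑ z ∈ T, F z ^ 2 ≤ ∑ _z ∈ T, B ^ 2 := Finset.sum_le_sum fun z hz => by
          have := hB z hz
          rw [← sq_abs]; exact pow_le_pow_left₀ (abs_nonneg _) this 2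
    _ = T.card * B ^ 2 := by rw [Finset.sum_const, nsmul_eq_mul]

/-- **WEIGHTED ℓ² OF A SUPPORTED SITE FIELD**: `√Σ_z(ω z·F z)² ≤ Ω·B·√|T|` if `|F| ≤ B` on `T`, `F = 0` off `T`, `0 ≤ ω ≤ Ω` on `T`. [folklore] -/
theorem sqrt_sum_sq_weighted_le_of_supported (T : Finset (Site P j)) (ω F : SiteField P j ℝ) {B Ω : ℝ} (hB0 : 0 ≤ B) (hΩ0 : 0 ≤ Ω)
    (hω0 : ∀ z, 0 ≤ ω z) (hωT : ∀ z ∈ T, ω z ≤ Ω)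
    (hB : ∀ z ∈ T, |F z| ≤ B) (h0 : ∀ z ∉ T, F z = 0) :
    Real.sqrt (∑ z, (ω z * F z) ^ 2) ≤ Ω * B * Real.sqrt T.card := by
  have h := sum_sq_le_card_mul_sq_of_supported T (fun z => ω z * F z) (B := Ω * B)
    (fun z hz => by
      rw [abs_mul, abs_of_nonneg (hω0 z)]
      exact mul_le_mul (hωT z hz) (hB z hz) (abs_nonneg _) hΩ0)
    (fun z hz => by simp [h0 z hz])
  calc Real.sqrt (∑ z, (ω z * F z) ^ 2) ≤ Real.sqrt (T.card * (Ω * B) ^ 2) := Real.sqrt_le_sqrt h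
    _ = Ω * B * Real.sqrt T.card := by
        rw [Real.sqrt_mul (Nat.cast_nonneg _), Real.sqrt_sq (mul_nonneg hΩ0 hB0), mul_comm]

/-- **WEIGHTED ℓ² OF A SUPPORTED BOND FIELD** (weight read at the source): `√Σ_b(ω(b₋)·H(b))² ≤ Ω·B·√(d·|T|)` if `|H(b)| ≤ B` for `b₋ ∈ T`, `H(b) = 0` for `b₋ ∉ T`,
`0 ≤ ω ≤ Ω` on `T`. [folklore] -/
theorem sqrt_sum_sq_weighted_bond_le_of_supported (T : Finset (Site P j)) (ω : SiteField P j ℝ) (H : VecField P j ℝ) {B Ω : ℝ}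
    (hB0 : 0 ≤ B) (hΩ0 : 0 ≤ Ω) (hω0 : ∀ z, 0 ≤ ω z) (hωT : ∀ z ∈ T, ω z ≤ Ω)
    (hB : ∀ b : PBond P j, b.src ∈ T → |H b| ≤ B) (h0 : ∀ b : PBond P j, b.src ∉ T → H b = 0) :
    Real.sqrt (∑ b : PBond P j, (ω b.src * H b) ^ 2) ≤ Ω * B * Real.sqrt (P.d * T.card) := by
  classical
  have hsum : ∑ b : PBond P j, (ω b.src * H b) ^ 2 ≤ (P.d * T.card : ℝ) * (Ω * B) ^ 2 := by
    rw [sum_pbond]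
    have hx : ∀ x : Site P j, ∑ μ : Fin P.d, (ω x * H ⟨x, μ⟩) ^ 2 ≤ (if x ∈ T then P.d * (Ω * B) ^ 2 else 0) := by
      intro x
      by_cases hxT : x ∈ T
      · rw [if_pos hxT]
        calc ∑ μ : Fin P.d, (ω x * H ⟨x, μ⟩) ^ 2 ≤ ∑ _μ : Fin P.d, (Ω * B) ^ 2 := Finset.sum_le_sum fun μ _ => by
                have h1 : |ω x * H ⟨x, μ⟩| ≤ Ω * B := by
                  rw [abs_mul, abs_of_nonneg (hω0 x)]
                  exact mul_le_mul (hωT x hxT) (hB ⟨x, μ⟩ hxT) (abs_nonneg _) hΩ0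
                rw [← sq_abs]; exact pow_le_pow_left₀ (abs_nonneg _) h1 2
          _ = P.d * (Ω * B) ^ 2 := by rw [Finset.sum_const, Finset.card_univ, Fintype.card_fin, nsmul_eq_mul]
      · rw [if_neg hxT]
        refine (Finset.sum_eq_zero fun μ _ => ?_).le
        rw [h0 ⟨x, μ⟩ hxT]; ring
    calc ∑ x : Site P j, ∑ μ : Fin P.d, (ω x * H ⟨x, μ⟩) ^ 2 ≤ ∑ x : Site P j, (if x ∈ T then (P.d : ℝ) * (Ω * B) ^ 2 else 0) :=
          Finset.sum_le_sum fun x _ => hx x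
      _ = (P.d * T.card : ℝ) * (Ω * B) ^ 2 := by
          rw [Finset.sum_ite_mem, Finset.univ_inter, Finset.sum_const, nsmul_eq_mul]; ring
  calc Real.sqrt (∑ b : PBond P j, (ω b.src * H b) ^ 2) ≤ Real.sqrt ((P.d * T.card : ℝ) * (Ω * B) ^ 2) := Real.sqrt_le_sqrt hsum
    _ = Ω * B * Real.sqrt (P.d * T.card) := by
        rw [Real.sqrt_mul (by positivity), Real.sqrt_sq (mul_nonneg hΩ0 hB0), mul_comm]

/-- `Σ_z|F z| ≤ |T|·B` for a supported field. [folklore] -/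
theorem sum_abs_le_card_mul_of_supported (T : Finset (Site P j)) (F : SiteField P j ℝ) {B : ℝ}
    (hB : ∀ z ∈ T, |F z| ≤ B) (h0 : ∀ z ∉ T, F z = 0) :
    ∑ z, |F z| ≤ T.card * B := by
  classical
  have hsplit : ∑ z, |F z| = ∑ z ∈ T, |F z| := by
    rw [← Finset.sum_subset (Finset.subset_univ T)]
    intro z _ hz
    rw [h0 z hz, abs_zero]
  rw [hsplit]
  calc ∑ z ∈ T, |F z| ≤ ∑ _z ∈ T, B := Finset.sum_le_sum hB
    _ = T.card * B := by rw [Finset.sum_const, nsmul_eq_mul]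

/-! ## §2 ★★ The three sources of ✓ `el_of_peeled` and the commutator half of `N₂` -/

/-- ★★ **`Nh`**: with `ΔV = g`, `χ` locally constant off `T`, the cutoff rows `C₁, C₂` and the rows `D₁` (symmetric difference of `V`), `D₀` (size of `V`) on `T`, and a weight
`0 ≤ ω ≤ Ω` on `T`:  `√Σ_z(ω·(χg − Δ(χV)))² ≤ Ω·(d·c²(C₁D₁ + C₂D₀))·√|T|`. [cite: Balaban1984PropagatorsII, (1.9) p.226] -/
theorem sqrt_sum_sq_weighted_h_le (c : ℝ) (T : Finset (Site P j)) (χ V g ω : SiteField P j ℝ) {C₁ C₂ D₀ D₁ Ω : ℝ}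
    (hg : laplace c V = g) (hC₁ : 0 ≤ C₁) (hC₂ : 0 ≤ C₂) (hD₀ : 0 ≤ D₀) (hD₁ : 0 ≤ D₁) (hΩ0 : 0 ≤ Ω)
    (hχT : ∀ z ∉ T, ∀ μ, χ (z.shift μ) = χ z ∧ χ (z.unshift μ) = χ z)
    (hχ₁ : ∀ z ∈ T, ∀ μ, |χ (z.shift μ) - χ z| ≤ C₁) (hχ₂ : ∀ z ∈ T, ∀ μ, |χ (z.shift μ) + χ (z.unshift μ) - 2 * χ z| ≤ C₂)
    (hV₁ : ∀ z ∈ T, ∀ μ, |V (z.shift μ) - V (z.unshift μ)| ≤ D₁) (hV₀ : ∀ z ∈ T, ∀ μ, |V (z.unshift μ)| ≤ D₀)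
    (hω0 : ∀ z, 0 ≤ ω z) (hωT : ∀ z ∈ T, ω z ≤ Ω) :
    Real.sqrt (∑ z, (ω z * (χ z * g z - laplace c (fun y => χ y * V y) z)) ^ 2)
      ≤ Ω * (P.d * (c ^ 2 * (C₁ * D₁ + C₂ * D₀))) * Real.sqrt T.card := by
  refine sqrt_sum_sq_weighted_le_of_supported T ω _ (by positivity) hΩ0 hω0 hωT (fun z hz => ?_) (fun z hz => ?_)
  · rw [h_eq_neg_comm c χ V g hg z, abs_neg]
    exact abs_laplace_mul_sub_mul_laplace_le c χ V z (hχ₁ z hz) (hχ₂ z hz) (hV₁ z hz) (hV₀ z hz)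
  · exact h_eq_zero_of_locally_const c χ V g hg z (hχT z hz)

/-- ★★ **`Nht`**: `√Σ_b(ω(b₋)·(−g(b₋)∂χ(b)))² ≤ Ω·(Dg·(|c|·C₁))·√(d·|T|)` from `|g| ≤ Dg` on `T` and the first-difference row of `χ`. [cite: Balaban1984PropagatorsII, (1.9) p.226] -/
theorem sqrt_sum_sq_weighted_ht_le (c : ℝ) (T : Finset (Site P j)) (χ g ω : SiteField P j ℝ) {C₁ Dg Ω : ℝ}
    (hC₁ : 0 ≤ C₁) (hDg : 0 ≤ Dg) (hΩ0 : 0 ≤ Ω)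
    (hχT : ∀ z ∉ T, ∀ μ, χ (z.shift μ) = χ z ∧ χ (z.unshift μ) = χ z)
    (hχ₁ : ∀ z ∈ T, ∀ μ, |χ (z.shift μ) - χ z| ≤ C₁) (hgT : ∀ z ∈ T, |g z| ≤ Dg)
    (hω0 : ∀ z, 0 ≤ ω z) (hωT : ∀ z ∈ T, ω z ≤ Ω) :
    Real.sqrt (∑ b : PBond P j, (ω b.src * (-(g b.src * grad c χ b))) ^ 2) ≤ Ω * (Dg * (|c| * C₁)) * Real.sqrt (P.d * T.card) := by
  refine sqrt_sum_sq_weighted_bond_le_of_supported T ω _ (by positivity) hΩ0 hω0 hωT (fun b hb => ?_) (fun b hb => ?_)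
  · rw [abs_neg, abs_mul]
    refine mul_le_mul (hgT b.src hb) ?_ (abs_nonneg _) hDg
    simp only [grad, PBond.tgt, smul_eq_mul, abs_mul]
    exact mul_le_mul_of_nonneg_left (hχ₁ b.src hb b.dir) (abs_nonneg c)
  · have h := (hχT b.src hb b.dir).1
    simp [grad, PBond.tgt, h]

/-- ★★ **`Ns`**: `√Σ_z(ω·Σ_μ∂χ(z,μ)∂g(z,μ))² ≤ Ω·(d·(|c|C₁·(|c|·Dg′)))·√|T|` from `|g(z+μ) − g(z)| ≤ Dg′` on `T` and the first-difference row of `χ`.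
[cite: Balaban1984PropagatorsII, (1.9) p.226] -/
theorem sqrt_sum_sq_weighted_s_le (c : ℝ) (T : Finset (Site P j)) (χ g ω : SiteField P j ℝ) {C₁ Dg' Ω : ℝ}
    (hC₁ : 0 ≤ C₁) (hDg' : 0 ≤ Dg') (hΩ0 : 0 ≤ Ω)
    (hχT : ∀ z ∉ T, ∀ μ, χ (z.shift μ) = χ z ∧ χ (z.unshift μ) = χ z)
    (hχ₁ : ∀ z ∈ T, ∀ μ, |χ (z.shift μ) - χ z| ≤ C₁) (hg₁ : ∀ z ∈ T, ∀ μ, |g (z.shift μ) - g z| ≤ Dg')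
    (hω0 : ∀ z, 0 ≤ ω z) (hωT : ∀ z ∈ T, ω z ≤ Ω) :
    Real.sqrt (∑ z, (ω z * (∑ μ : Fin P.d, grad c χ ⟨z, μ⟩ * grad c g ⟨z, μ⟩)) ^ 2)
      ≤ Ω * (P.d * (|c| * C₁ * (|c| * Dg'))) * Real.sqrt T.card := by
  refine sqrt_sum_sq_weighted_le_of_supported T ω _ (by positivity) hΩ0 hω0 hωT (fun z hz => ?_) (fun z hz => ?_)
  · calc |∑ μ : Fin P.d, grad c χ ⟨z, μ⟩ * grad c g ⟨z, μ⟩| ≤ ∑ μ : Fin P.d, |grad c χ ⟨z, μ⟩ * grad c g ⟨z, μ⟩| := Finset.abs_sum_le_sum_abs _ _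
      _ ≤ ∑ _μ : Fin P.d, |c| * C₁ * (|c| * Dg') := Finset.sum_le_sum fun μ _ => by
          rw [abs_mul]
          simp only [grad, PBond.tgt, smul_eq_mul, abs_mul]
          exact mul_le_mul (mul_le_mul_of_nonneg_left (hχ₁ z hz μ) (abs_nonneg c))
            (mul_le_mul_of_nonneg_left (hg₁ z hz μ) (abs_nonneg c)) (by positivity) (by positivity)
      _ = P.d * (|c| * C₁ * (|c| * Dg')) := by rw [Finset.sum_const, Finset.card_univ, Fintype.card_fin, nsmul_eq_mul]
  · exact s_eq_zero_of_locally_const c χ g z fun μ => (hχT z hz μ).1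

/-- ★ **THE COMMUTATOR HALF OF `N₂`**: `Σ_z|Δ(χV)(z)| ≤ Σ_z|χ(z)g(z)| + |T|·d·c²(C₁D₁ + C₂D₀)` (`Δ(χV) = χg + [Δ,χ]V`). [cite: Balaban1985RegularSpaces, (1.36) p.82] -/
theorem sum_abs_laplace_mul_le (c : ℝ) (T : Finset (Site P j)) (χ V g : SiteField P j ℝ) {C₁ C₂ D₀ D₁ : ℝ}
    (hg : laplace c V = g)
    (hχT : ∀ z ∉ T, ∀ μ, χ (z.shift μ) = χ z ∧ χ (z.unshift μ) = χ z)
    (hχ₁ : ∀ z ∈ T, ∀ μ, |χ (z.shift μ) - χ z| ≤ C₁) (hχ₂ : ∀ z ∈ T, ∀ μ, |χ (z.shift μ) + χ (z.unshift μ) - 2 * χ z| ≤ C₂)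
    (hV₁ : ∀ z ∈ T, ∀ μ, |V (z.shift μ) - V (z.unshift μ)| ≤ D₁) (hV₀ : ∀ z ∈ T, ∀ μ, |V (z.unshift μ)| ≤ D₀) :
    ∑ z, |laplace c (fun y => χ y * V y) z| ≤ ∑ z, |χ z * g z| + T.card * (P.d * (c ^ 2 * (C₁ * D₁ + C₂ * D₀))) := by
  have hsplit : ∀ z, laplace c (fun y => χ y * V y) z = χ z * g z + (laplace c (fun y => χ y * V y) z - χ z * laplace c V z) := by
    intro z; rw [hg]; ring
  have hcomm := sum_abs_le_card_mul_of_supported T (fun z => laplace c (fun y => χ y * V y) z - χ z * laplace c V z)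
    (fun z hz => abs_laplace_mul_sub_mul_laplace_le c χ V z (hχ₁ z hz) (hχ₂ z hz) (hV₁ z hz) (hV₀ z hz))
    (fun z hz => laplace_mul_sub_mul_laplace_eq_zero c χ V z (hχT z hz))
  calc ∑ z, |laplace c (fun y => χ y * V y) z|
      = ∑ z, |χ z * g z + (laplace c (fun y => χ y * V y) z - χ z * laplace c V z)| := Finset.sum_congr rfl fun z _ => congrArg abs (hsplit z)
    _ ≤ ∑ z, (|χ z * g z| + |laplace c (fun y => χ y * V y) z - χ z * laplace c V z|) := Finset.sum_le_sum fun z _ => abs_add_le _ _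
    _ = ∑ z, |χ z * g z| + ∑ z, |laplace c (fun y => χ y * V y) z - χ z * laplace c V z| := Finset.sum_add_distrib
    _ ≤ _ := add_le_add le_rfl hcomm

end Summit.QuantumFields.YangMills.Theorems.Prop7PinnedKernelSources

end
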